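import Mathlib
import Summits.AtomisticToContinuum.HydrodynamicLimit.Theorems.ImplosionDichotomyDenseExcursionSonicConfinementOrderZero

/-!
# The mode ODE in characteristic form, its Levinson (slow/fast) form, and the outgoing ratio at the sonic point
# (crux `DenseExcursion`, line `sonic-cavity-renewal`, bricks for stub `stub_sonicConfinement`)

Helper file (`--supports stmt-AtomisticToContinuum-12586`, line lead a2, stub-worker for `stub_sonicConfinement`).

With `p = ŵ + 3ŝ`, `m = ŵ − 3ŝ` (the components along the left eigen-rows `ℓ± = (1, ±3)` of the principal symbol), the
mode equations `Λ ŵ = linW`, `Λ ŝ = linS` (`…R2Modes`) are the CHARACTERISTIC SYSTEM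
  `c₊ p′ = (Λ − b₊₊) p − b₊₋ m`, `c₋ m′ = −b₋₊ p + (Λ − b₋₋) m`,
  `c± = (W − 1) ± S`, `b₊₊ = ⅔W′ + 2W − r + 2S′ + 4S`, `b₊₋ = W′/3 + S′ + 2S`, `b₋₊ = W′/3 − S′ − 2S`, `b₋₋ = ⅔W′ + 2W − r − 2S′ − 4S`
(`mode_char_system`, pure algebra from `lin_characteristic_rows`). Where both speeds are non-zero, factoring out the phase of the
`−` family, `u = e^{−θ} m`, `w = e^{−θ} p`, `θ′ = (Λ − b₋₋)/c₋`, gives the triangular-interaction (Levinson) form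
  `u′ = α w`, `w′ = q w + β u`, `α = −b₋₊/c₋`, `β = −b₊₋/c₊`, `q = (Λ − b₊₊)/c₊ − (Λ − b₋₋)/c₋`
(`mode_levinson_form`, registered helper) — exactly the hypotheses `hu`, `hw` of `levinson_fast_bound` / `levinson_conversion`
(`…SonicConfinementLevinson`), with `|q| ≥ |Im Λ|·(1/c₊ + 1/|c₋|)` on the core `x < 0` (`c₊ > 0 > c₋`).
Finally `sonic_outgoing_ratio`: at the sonic point of a tube profile a smooth mode satisfies `(Λ − b₊₊(0)) p(0) = b₊₋(0) m(0)` with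
`|b₊₋(0)| ≤ 3/2` (CavityTube (c)), hence `|Im Λ|·‖p(0)‖ ≤ (3/2)‖m(0)‖`: the smooth branch is outgoing up to `O(1/|Im Λ|)`.

Sources: Chen–Shkoller–Vicol arXiv:2605.00808 §1.10; Coppel 1965 Ch. IV. NOT here: the stub itself (see the worker report).
-/

noncomputable section

open Set

namespace Summit.AtomisticToContinuum.HydrodynamicLimit.Theorems.SonicCavityRenewal

open Summit.AtomisticToContinuum.HydrodynamicLimit.Theorems.R2OneModeTwoConditions

/-- THE CHARACTERISTIC SYSTEM (pointwise algebra): the mode equations at `x` are equivalent to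
`c₊ (ŵ′ + 3ŝ′) = (Λ − b₊₊)(ŵ + 3ŝ) − b₊₋ (ŵ − 3ŝ)` and `c₋ (ŵ′ − 3ŝ′) = −b₋₊ (ŵ + 3ŝ) + (Λ − b₋₋)(ŵ − 3ŝ)` with the coefficients of the
file header. [folklore] -/
theorem mode_char_system {r : ℝ} {W S : ℝ → ℝ} {Λ : ℂ} {ŵ ŝ : ℝ → ℂ} {x : ℝ}
    (h : Λ * ŵ x = linW r W S ŵ ŝ x ∧ Λ * ŝ x = linS r W S ŵ ŝ x) :
    ((W x - 1 + S x : ℝ) : ℂ) * (deriv ŵ x + 3 * deriv ŝ x) =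
        (Λ - ((2 / 3 * deriv W x + 2 * W x - r + 2 * deriv S x + 4 * S x : ℝ) : ℂ)) * (ŵ x + 3 * ŝ x) -
          ((deriv W x / 3 + deriv S x + 2 * S x : ℝ) : ℂ) * (ŵ x - 3 * ŝ x) ∧
      ((W x - 1 - S x : ℝ) : ℂ) * (deriv ŵ x - 3 * deriv ŝ x) =
        -((deriv W x / 3 - deriv S x - 2 * S x : ℝ) : ℂ) * (ŵ x + 3 * ŝ x) +
          (Λ - ((2 / 3 * deriv W x + 2 * W x - r - 2 * deriv S x - 4 * S x : ℝ) : ℂ)) * (ŵ x - 3 * ŝ x) := by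
  obtain ⟨h1, h2⟩ := h
  unfold linW at h1
  unfold linS at h2
  push_cast at h1 h2 ⊢
  constructor
  · linear_combination (-1 : ℂ) * h1 - 3 * h2
  · linear_combination (-1 : ℂ) * h1 + 3 * h2

/-- The characteristic components `p = ŵ + 3ŝ`, `m = ŵ − 3ŝ` of a differentiable pair are differentiable with the expected
derivatives. [folklore] -/
theorem hasDerivAt_char_components {ŵ ŝ : ℝ → ℂ} {x : ℝ} (hŵ : DifferentiableAt ℝ ŵ x)
    (hŝ : DifferentiableAt ℝ ŝ x) :
    HasDerivAt (fun y => ŵ y + 3 * ŝ y) (deriv ŵ x + 3 * deriv ŝ x) x ∧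
      HasDerivAt (fun y => ŵ y - 3 * ŝ y) (deriv ŵ x - 3 * deriv ŝ x) x :=
  ⟨hŵ.hasDerivAt.add (hŝ.hasDerivAt.const_mul 3), hŵ.hasDerivAt.sub (hŝ.hasDerivAt.const_mul 3)⟩

/-- **THE LEVINSON FORM OF THE MODE SYSTEM** — registered helper `mode_levinson_form` for `stub_sonicConfinement`. At a point where
both characteristic speeds are non-zero, for any local phase `θ` of the `−` family (`θ′ = (Λ − b₋₋)/c₋` at `x`), the amplitudes
`u = e^{−θ}(ŵ − 3ŝ)`, `w = e^{−θ}(ŵ + 3ŝ)` of a solution of the mode equations satisfy the triangular-interaction system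
`u′ = α w`, `w′ = q w + β u` with `α = −b₋₊/c₋`, `β = −b₊₋/c₊`, `q = (Λ − b₊₊)/c₊ − (Λ − b₋₋)/c₋` — the hypotheses of
`levinson_fast_bound`; `|q| ≥ |Im q| = |Im Λ| (1/c₊ − 1/c₋)`. [folklore] -/
theorem mode_levinson_form : ∀ (r : ℝ) (W S : ℝ → ℝ) (Λ : ℂ) (ŵ ŝ θ : ℝ → ℂ) (x : ℝ), DifferentiableAt ℝ ŵ x → DifferentiableAt ℝ ŝ x → (Λ * ŵ x = linW r W S ŵ ŝ x ∧ Λ * ŝ x = linS r W S ŵ ŝ x) → W x - 1 + S x ≠ 0 → W x - 1 - S x ≠ 0 → HasDerivAt θ ((Λ - ((2 / 3 * deriv W x + 2 * W x - r - 2 * deriv S x - 4 * S x : ℝ) : ℂ)) / ((W x - 1 - S x : ℝ) : ℂ)) x → HasDerivAt (fun y => Complex.exp (-θ y) * (ŵ y - 3 * ŝ y)) (-((deriv W x / 3 - deriv S x - 2 * S x : ℝ) : ℂ) / ((W x - 1 - S x : ℝ) : ℂ) * (Complex.exp (-θ x) * (ŵ x + 3 * ŝ x))) x ∧ HasDerivAt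 (fun y => Complex.exp (-θ y) * (ŵ y + 3 * ŝ y)) (((Λ - ((2 / 3 * deriv W x + 2 * W x - r + 2 * deriv S x + 4 * S x : ℝ) : ℂ)) / ((W x - 1 + S x : ℝ) : ℂ) - (Λ - ((2 / 3 * deriv W x + 2 * W x - r - 2 * deriv S x - 4 * S x : ℝ) : ℂ)) / ((W x - 1 - S x : ℝ) : ℂ)) * (Complex.exp (-θ x) * (ŵ x + 3 * ŝ x)) + -((deriv W x / 3 + deriv S x + 2 * S x : ℝ) : ℂ) / ((W x - 1 + S x : ℝ) : ℂ) * (Complex.exp (-θ x) * (ŵ x - 3 * ŝ x))) x := by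
  intro r W S Λ ŵ ŝ θ x hŵ hŝ h hp hm hθ
  obtain ⟨c1, c2⟩ := mode_char_system h
  obtain ⟨dp, dm⟩ := hasDerivAt_char_components hŵ hŝ
  have hp' : ((W x - 1 + S x : ℝ) : ℂ) ≠ 0 := Complex.ofReal_ne_zero.2 hp
  have hm' : ((W x - 1 - S x : ℝ) : ℂ) ≠ 0 := Complex.ofReal_ne_zero.2 hm
  have hicp : ((W x - 1 + S x : ℝ) : ℂ) * ((W x - 1 + S x : ℝ) : ℂ)⁻¹ = 1 := mul_inv_cancel₀ hp'
  have hicm : ((W x - 1 - S x : ℝ) : ℂ) * ((W x - 1 - S x : ℝ) : ℂ)⁻¹ = 1 := mul_inv_cancel₀ hm'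
  have he : HasDerivAt (fun y => Complex.exp (-θ y)) (Complex.exp (-θ x) *
      -((Λ - ((2 / 3 * deriv W x + 2 * W x - r - 2 * deriv S x - 4 * S x : ℝ) : ℂ)) / ((W x - 1 - S x : ℝ) : ℂ))) x :=
    hθ.neg.cexp
  push_cast at c1 c2 hicp hicm he ⊢
  constructor
  · refine (he.mul dm).congr_deriv ?_
    linear_combination Complex.exp (-θ x) * ((W x : ℂ) - 1 - (S x : ℂ))⁻¹ * c2 -
      Complex.exp (-θ x) * (deriv ŵ x - 3 * deriv ŝ x) * hicm
  · refine (he.mul dp).congr_deriv ?_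
    linear_combination Complex.exp (-θ x) * ((W x : ℂ) - 1 + (S x : ℂ))⁻¹ * c1 -
      Complex.exp (-θ x) * (deriv ŵ x + 3 * deriv ŝ x) * hicp

/-- THE SONIC RELATION IN CHARACTERISTIC COMPONENTS: at a point with `W 0 + S 0 = 1`,
`(Λ − b₊₊(0))·(ŵ 0 + 3ŝ 0) = b₊₋(0)·(ŵ 0 − 3ŝ 0)` (`sonic_order_zero` rewritten with `ŵ = (p + m)/2`, `ŝ = (p − m)/6`). [folklore] -/
theorem sonic_relation_char {r : ℝ} {W S : ℝ → ℝ} {Λ : ℂ} {ŵ ŝ : ℝ → ℂ} (h0 : W 0 + S 0 = 1)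
    (h : Λ * ŵ 0 = linW r W S ŵ ŝ 0 ∧ Λ * ŝ 0 = linS r W S ŵ ŝ 0) :
    (Λ - ((2 / 3 * deriv W 0 + 2 * W 0 - r + 2 * deriv S 0 + 4 * S 0 : ℝ) : ℂ)) * (ŵ 0 + 3 * ŝ 0) =
      ((deriv W 0 / 3 + deriv S 0 + 2 * S 0 : ℝ) : ℂ) * (ŵ 0 - 3 * ŝ 0) := by
  have := sonic_order_zero r W S Λ ŵ ŝ h0 h
  push_cast at this ⊢
  linear_combination this

/-- **OUTGOING RATIO AT THE SONIC POINT.** For a tube profile (`CavityTube`: sonic point at `0`, `C²` envelope (c) at `x = 0`: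
`|W′(0)| ≤ 1/2`, `7/10 ≤ S(0) ≤ 1`, `|S(0) + S′(0)| ≤ 1/4`, whence `|b₊₋(0)| ≤ 3/2`) every smooth radial mode satisfies
`|Im Λ|·‖ŵ 0 + 3ŝ 0‖ ≤ (3/2)·‖ŵ 0 − 3ŝ 0‖`: the degenerate (`+`) characteristic component at the sonic point is `O(1/|Im Λ|)` relative
to the regular (`−`) one — the smooth branch is asymptotically outgoing (mechanism (i) of the `|Im Λ|`-confinement). [folklore] -/
theorem sonic_outgoing_ratio {r : ℝ} {W S : ℝ → ℝ} {Λ : ℂ} {ŵ ŝ : ℝ → ℂ} (hP : IsMonatomicProfile r W S)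
    (hT : CavityTube r W S) (hmode : IsSmoothRadialMode r W S Λ ŵ ŝ) :
    |Λ.im| * ‖ŵ 0 + 3 * ŝ 0‖ ≤ 3 / 2 * ‖ŵ 0 - 3 * ŝ 0‖ := by
  obtain ⟨-, -, -, hS, -, -, -, -, -⟩ := hP
  obtain ⟨h0, -, -, -, -, -, -, hcW, hcS, -, -⟩ := hT
  have hS1 : Differentiable ℝ S := hS.differentiable (by simp)
  -- the tube bounds at `x = 0`
  obtain ⟨-, hW', -⟩ := hcW 0 (by norm_num)
  obtain ⟨hs₁, hs₂, hs', -⟩ := hcS 0 (by norm_num)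
  have hds : deriv (fun y => Real.exp y * S y) 0 = S 0 + deriv S 0 := by
    have h : HasDerivAt (fun y => Real.exp y * S y) (Real.exp 0 * S 0 + Real.exp 0 * deriv S 0) 0 :=
      (Real.hasDerivAt_exp 0).mul (hS1 0).hasDerivAt
    rw [h.deriv]
    simp
  rw [hds] at hs'
  rw [Real.exp_zero, one_mul] at hs₁ hs₂
  have hb : |deriv W 0 / 3 + deriv S 0 + 2 * S 0| ≤ 3 / 2 := by
    obtain ⟨hW₁, hW₂⟩ := abs_le.1 hW'
    obtain ⟨hs₃, hs₄⟩ := abs_le.1 hs'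
    exact abs_le.2 ⟨by linarith, by linarith⟩
  -- the sonic relation and norms
  have key := sonic_relation_char h0 (hmode.2.2 0)
  have hnorm := congrArg (fun z : ℂ => ‖z‖) key
  simp only [norm_mul, Complex.norm_real, Real.norm_eq_abs] at hnorm
  have him : |Λ.im| ≤ ‖Λ - ((2 / 3 * deriv W 0 + 2 * W 0 - r + 2 * deriv S 0 + 4 * S 0 : ℝ) : ℂ)‖ := by
    have := Complex.abs_im_le_norm (Λ - ((2 / 3 * deriv W 0 + 2 * W 0 - r + 2 * deriv S 0 + 4 * S 0 : ℝ) : ℂ))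
    simpa using this
  calc |Λ.im| * ‖ŵ 0 + 3 * ŝ 0‖
      ≤ ‖Λ - ((2 / 3 * deriv W 0 + 2 * W 0 - r + 2 * deriv S 0 + 4 * S 0 : ℝ) : ℂ)‖ * ‖ŵ 0 + 3 * ŝ 0‖ :=
        mul_le_mul_of_nonneg_right him (norm_nonneg _)
    _ = |deriv W 0 / 3 + deriv S 0 + 2 * S 0| * ‖ŵ 0 - 3 * ŝ 0‖ := hnorm
    _ ≤ 3 / 2 * ‖ŵ 0 - 3 * ŝ 0‖ := mul_le_mul_of_nonneg_right hb (norm_nonneg _)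

end Summit.AtomisticToContinuum.HydrodynamicLimit.Theorems.SonicCavityRenewal

end
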